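import Literature.NumberTheory.Automorphic.Liu2021.SplitPlaceOscillatorModel
import Literature.NumberTheory.GelbartRogawski1991.LocalUnitarySplitPlaceDarboux
import Literature.NumberTheory.GelbartRogawski1991.LocalSplittingUnitary
import Literature.NumberTheory.GelbartRogawski1991.LocalLeraySection
import Literature.NumberTheory.GelbartRogawski1991.LocalSplittingsDifferByCharacter
import Literature.RepresentationTheory.HeisenbergGroup.SchrodingerConjugateTorusSpherical
import Literature.RepresentationTheory.HeisenbergGroup.SchrodingerPiOperators
import HarnessLib

/-!
# The mixed (type II) model of the local Weil representation of `U(V)(F_v) ≅ GL_N(E_w)` at a SPLIT place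

Topic `NumberTheory/Automorphic/Liu2021`; namespace `Literature.NumberTheory.Automorphic.Liu2021.SplitPlaceMixedModel`.
KERNEL ONLY: theorems; no definition, no named fact, no `sorry`.

Setting of `Liu2021/SplitPlaceOscillatorModel.lean` (the named fact `splitPlace_chiCoinv_iso_parabolicIndGL`,
[Liu2021, App. D, proof of Lem. D.1, first paragraph, p. 126]; [MoeglinVignerasWaldspurger1987, Chap. 3 §III.1]): `E/F`
quadratic, `c`, `δ` (`c δ = -δ ≠ 0`, `δ² = d`), `T ∈ Sym_N(F)` with `det T` a unit, `J = T ⊗ 1`, a finite place `v` of `F`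
SPLIT in `E` (`w ∣ v`, `c • w ≠ w`, `J` invertible at `w`), the honest local Schrödinger model `ρ_v = localSchrodinger F N T v`
on `𝒮(F_vᴺ)`, its group of implementer pairs `LocalMp F N T v = S̃p_{ψ_v}(𝕎_v)` over `Sp(𝕎_v)`, the embedding
`ι_v : U(J)(F_v) →* Sp(𝕎_v)` and a SECTION `s : U(J)(F_v) →* S̃p_{ψ_v}(𝕎_v)` over `ι_v` with Weil representation
`ω_s = toRep ∘ s`.

MAIN RESULT (`exists_mixedModel`) — print's «We identify `U(V)` with `GL_n(F)` … through the first factor» made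
explicit on the tree's objects: **there are an `L²`-ISOMETRIC linear automorphism `Γ` of `𝒮(F_vᴺ)` and a character
`η : U(J)(F_v) →* ℂˣ` such that for every `a ∈ GL_N(F_v)` (`↦ κ_a ∈ U(J)(F_v)`, the element whose `w`-component is
`ι_w(a)`, tree `localPiSplitEquiv`) and every `Φ`,**
`ω_s(κ_a) Φ = η(κ_a) • Γ⁻¹ (r(m(a⁻ᵀ)) (Γ Φ))`, where `r(m(b)) Φ = |det b|^{-1/2} Φ(b⁻¹ ·)` is the tree's normalised Levi
operator `leviOpPi` — i.e. `GL_N(F_v)` acts, up to the character `η` and conjugation by `Γ`, by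
`Φ ↦ |det a|^{1/2} Φ(ᵗa ·)` (MVW's `σ ⊗ ν^{1/2}`, [MoeglinVignerasWaldspurger1987, Chap. 3 §III.1]).  PROOF: the tree's
`iota_localPiSplitEquiv_symm_map` (`ι_v(κ_a) = γ_w⁻¹ m(a) γ_w` for the integral Darboux element `γ_w` of the split place,
`LocalUnitarySplitPlaceDarboux.lean`) and `J m(a) J⁻¹ = m(a⁻ᵀ)` (`symJ_mul_levi`) give `ι_v(κ_a) = (J γ_w)⁻¹ m(a⁻ᵀ) (J γ_w)`;
an `L²`-isometric implementer `Γ` of `J γ_w` exists (`exists_isometric_implementer_localSchrodinger`) and `r(m(b))`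
implements `m(b)` (`implements_transportSp_levi`), so `κ ↦ (ι_v κ, Γ⁻¹ r(m(a_κ⁻ᵀ)) Γ)` is a second section over `ι_v`;
two sections differ by a character (`MpPsi.exists_twist_toRep_comp_of_proj_eq`, implementers unique up to scalars).
COROLLARIES: `norm_eq_one_of_isL2Isometric` — if `ω_s` is `L²`-isometric then `|η| = 1` (both sections are isometric);
`isOpen_ker_of_isSmooth` — if `ω_s` is smooth then `ker η` is open; `apply_localCenter` — the centre `U(J₁)(F_v) ∋ z₀`
acts through the scalar `a_w(ζ) · 1_N` (`iota_localCenter_eq`).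

This is milestone (1) «SplitPlaceMixedModel» of the KEY `b4-split-place-model` (cell hodgecm-mathlib); it does NOT prove
the named fact `splitPlace_chiCoinv_iso_parabolicIndGL` (the coinvariant computation [MVW87, III.7 a)] is the sequel) and
HC_CM is not mentioned further.

## References
* [Liu2021] Y. Liu, Camb. J. Math. 9 (2021), App. D, proof of Lemma D.1 (first paragraph), p. 126.
* [MoeglinVignerasWaldspurger1987] C. Mœglin, M.-F. Vignéras, J.-L. Waldspurger, LNM 1291 (1987), Chap. 2 II.1–II.2, II.6;
  Chap. 3 §III.1.
* [GelbartRogawski1991] S. Gelbart, J. Rogawski, Invent. Math. 105 (1991), §3.1 Remark p. 457, §3.2 p. 457.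
-/

set_option autoImplicit false

noncomputable section

open NumberField IsDedekindDomain Matrix
open _root_.MeasureTheory
open Literature.RepresentationTheory (SeesawScalar.twist SeesawScalar.twist_apply)
open Literature.RepresentationTheory.HeisenbergGroup Literature.RepresentationTheory.HeisenbergGroup.SymplecticMatrix
open Literature.NumberTheory.Automorphic Literature.NumberTheory.Automorphic.UnitaryGroup
open Literature.NumberTheory.GelbartRogawski1991.UnitaryDualPair.LocalSplitting

namespace Literature.NumberTheory.Automorphic.Liu2021.SplitPlaceMixedModel

/-! ## §1 Symplectic algebra: `J m(a) = m(a⁻ᵀ) J` -/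

/-- **`J · m(a) = m(a⁻ᵀ) · J`** in `Sp_{2l}(R)`: conjugation by the Weyl element `J` replaces the Siegel Levi element
`m(a) = diag(a, a⁻ᵀ)` by `m(a⁻ᵀ) = diag(a⁻ᵀ, a)`. [cite: MoeglinVignerasWaldspurger1987, Chap. 2 II.2] -/
theorem symJ_mul_levi {l R : Type*} [DecidableEq l] [Fintype l] [CommRing R] (a : GL l R) :
    SymplecticGroup.symJ l R * levi a = levi (GLn.contragredient a) * SymplecticGroup.symJ l R := by
  apply Subtype.ext
  simp only [coe_levi, Submonoid.coe_mul, SymplecticGroup.coe_J, Matrix.J, fromBlocks_multiply, Matrix.mul_zero,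
    Matrix.zero_mul, Matrix.one_mul, Matrix.mul_one, add_zero, zero_add, GLn.coe_contragredient,
    GLn.coe_contragredient_inv, Matrix.transpose_transpose, Matrix.neg_mul, Matrix.mul_neg, neg_zero]

/-- hence `g⁻¹ m(a) g = (J g)⁻¹ m(a⁻ᵀ) (J g)` for every `g`, in any group receiving `Sp_{2l}(R)` by a homomorphism `φ`.
[cite: MoeglinVignerasWaldspurger1987, Chap. 2 II.2] -/
theorem conj_levi_eq_conj_symJ_levi {l R : Type*} [DecidableEq l] [Fintype l] [CommRing R] {G : Type*} [Group G]
    (φ : Matrix.symplecticGroup l R →* G) (g : G) (a : GL l R) :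
    g⁻¹ * φ (levi a) * g =
      (φ (SymplecticGroup.symJ l R) * g)⁻¹ * φ (levi (GLn.contragredient a)) * (φ (SymplecticGroup.symJ l R) * g) := by
  have h : φ (SymplecticGroup.symJ l R) * φ (levi a) = φ (levi (GLn.contragredient a)) * φ (SymplecticGroup.symJ l R) := by
    rw [← map_mul, symJ_mul_levi, map_mul]
  have h' : φ (levi (GLn.contragredient a)) =
      φ (SymplecticGroup.symJ l R) * φ (levi a) * (φ (SymplecticGroup.symJ l R))⁻¹ := by
    rw [h, mul_inv_cancel_right]
  rw [h']
  group

/-! ## §2 At a split place: `ι_v(κ_a) = (J γ_w)⁻¹ m(a⁻ᵀ) (J γ_w)` -/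

section Place

variable (F : Type) [Field F] [NumberField F] (E : Type) [Field E] [NumberField E] [Algebra F E]
  [Algebra.IsQuadraticExtension F E] (c : E ≃ₐ[F] E) (N : ℕ)
  {δ : E} (hcδ : c δ = -δ) (hδ : δ ≠ 0) {d : F} (hd : δ * δ = algebraMap F E d)
  (T : Matrix (Fin N) (Fin N) F) (hT : T.IsSymm) (hTd : IsUnit T.det)
  {J : Matrix (Fin N) (Fin N) E} (hJ : J = T.map (algebraMap F E))
  (v : HeightOneSpectrum (𝓞 F))

include hTd in
/-- `𝕋_v = T ⊗ 1` is invertible. [folklore] -/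
private theorem isUnit_det_localGram : IsUnit (localGram F N T v).det :=
  UnitaryGroup.isUnit_det_map (algebraMap F (v.adicCompletion F)) hTd

include hd hTd in
/-- **`ι_v(κ_a) = (J_v γ_w)⁻¹ · m(a⁻ᵀ) · (J_v γ_w)`**: the element `κ_a ∈ U(J)(F_v)` with `w`-component `ι_w(a)`,
`a ∈ GL_N(F_v)` (tree `localPiSplitEquiv`), acts on `𝕎_v` as the conjugate of the Siegel Levi element `m(a⁻ᵀ)` by
`J_v γ_w` (`γ_w` the integral Darboux element of the split place, `J_v = transportSp 𝕋_v J` the Weyl element) — the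
tree's `ι_v(κ_a) = γ_w⁻¹ m(a) γ_w` and `J m(a) J⁻¹ = m(a⁻ᵀ)`.
[cite: MoeglinVignerasWaldspurger1987, Chap. 3 §III.1; GelbartRogawski1991, §3.2 p. 457] -/
theorem iota_symm_map_eq_conj (hc : c ≠ 1) (hJc : (J.map c)ᵀ = J) (w : UnitaryGroup.PlacesOver E v) (hw : c • w.1 ≠ w.1)
    (hJw : IsUnit (placeForm J w.1)) (a : GL (Fin N) (v.adicCompletion F)) :
    iota F E c N hcδ hδ hd T hT hJ v
        ((localPiSplitEquiv c J hc hJc w hw hJw).symm (Matrix.GeneralLinearGroup.map (toPlace v w) a)) =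
      (transportSp (localGram F N T v) (isUnit_det_localGram F N T hTd v) (SymplecticGroup.symJ _ _) *
          splitDarboux F E c N hcδ hδ hd T v hT w hw)⁻¹ *
        transportSp (localGram F N T v) (isUnit_det_localGram F N T hTd v) (levi (GLn.contragredient a)) *
        (transportSp (localGram F N T v) (isUnit_det_localGram F N T hTd v) (SymplecticGroup.symJ _ _) *
          splitDarboux F E c N hcδ hδ hd T v hT w hw) := by
  rw [iota_localPiSplitEquiv_symm_map F E c N hcδ hδ hd T hJ v hT hTd (isUnit_det_localGram F N T hTd v) hc hJc w hw
    hJw a]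
  exact conj_levi_eq_conj_symJ_levi _ _ a

/-! ## §3 The Levi operators `r(m(a⁻ᵀ))` as a homomorphism and as implementers -/

/-- `a ↦ (x ↦ a x)` is multiplicative: `glEquiv (a b) = glEquiv a * glEquiv b`. [folklore] -/
private theorem glEquiv_mul (a b : GL (Fin N) (v.adicCompletion F)) : glEquiv (a * b) = glEquiv a * glEquiv b := by
  apply LinearEquiv.ext
  intro x
  rw [LinearEquiv.mul_apply, glEquiv_apply, glEquiv_apply, glEquiv_apply, Units.val_mul, Matrix.mulVec_mulVec]

/-- `r(m(a⁻ᵀ)) r(m(b⁻ᵀ)) = r(m((ab)⁻ᵀ))`: the normalised Levi operators composed with the contragredient form a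
homomorphism `GL_N(F_v) → GL(𝒮(F_vᴺ))`. [cite: Rangarao1993, Thm 3.5 (3)] -/
theorem leviOpPi_contragredient_mul (a b : GL (Fin N) (v.adicCompletion F)) :
    leviOpPi (glEquiv (GLn.contragredient (a * b))) =
      leviOpPi (glEquiv (GLn.contragredient a)) * leviOpPi (glEquiv (GLn.contragredient b)) := by
  rw [map_mul, glEquiv_mul, leviOpPi_mul]

/-- **`(r(m(a⁻ᵀ)) Φ)(x) = |det a|^{1/2}-normalised `Φ(ᵗa x)`**: precisely
`(leviOpPi (glEquiv a⁻ᵀ) Φ) x = (modSqrt (glEquiv a⁻ᵀ))⁻¹ · Φ(aᵀ x)`. [cite: MoeglinVignerasWaldspurger1987, Chap. 3 §III.1] -/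
theorem coe_leviOpPi_contragredient_apply (a : GL (Fin N) (v.adicCompletion F)) (Φ : (SchwartzBruhat (Fin N → v.adicCompletion F))) (x : Fin N → (v.adicCompletion F)) :
    ((leviOpPi (glEquiv (GLn.contragredient a)) Φ : (SchwartzBruhat (Fin N → v.adicCompletion F))) : (Fin N → (v.adicCompletion F)) → ℂ) x =
      ((modSqrt (glEquiv (GLn.contragredient a)) : ℂ))⁻¹ *
        (Φ : (Fin N → (v.adicCompletion F)) → ℂ) (((a : GL (Fin N) (v.adicCompletion F)) : Matrix (Fin N) (Fin N) (v.adicCompletion F))ᵀ *ᵥ x) := by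
  rw [coe_leviOpPi_apply, glEquiv_symm_apply, GLn.coe_contragredient_inv]

include hTd in
/-- `r(m(b))` implements `m(b)` on the local Schrödinger model (the scalar `|det b|^{-1/2}` is immaterial).
[cite: MoeglinVignerasWaldspurger1987, Chap. 2 II.6; Weil1964, n° 13, p. 160] -/
theorem implements_leviOpPi (b : GL (Fin N) (v.adicCompletion F)) :
    Implements (localSchrodinger F N T v)
      (ofSymplectic _ (transportSp (localGram F N T v) (isUnit_det_localGram F N T hTd v) (levi b)))
      (leviOpPi (glEquiv b)) := by
  have h1 := implements_transportSp_levi (localGram F N T v) (isUnit_det_localGram F N T hTd v)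
    (isLocallyConstant_of_isContinuousNontrivial (isContinuousNontrivial_adeleAddCharAt F v))
    (continuous_toLinearMap₂'_left (localGram F N T v)) b
  have h0 : Implements (localSchrodinger F N T v) 1 (scalarOp (S := (SchwartzBruhat (Fin N → v.adicCompletion F))) (modSqrtUnit (glEquiv b))⁻¹) := by
    have := (mem_MpPsi (localSchrodinger F N T v) _).1 (one_scalarOp_mem_MpPsi (localSchrodinger F N T v)
      (modSqrtUnit (glEquiv b))⁻¹)
    rwa [map_one] at this
  have := Implements.mul _ h0 h1
  rwa [one_mul] at this

/-! ## §4 The mixed model: `ω_s(κ_a) = η(κ_a) · Γ⁻¹ r(m(a⁻ᵀ)) Γ` -/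

set_option maxHeartbeats 400000 in
include hd hTd in
/-- **THE MIXED (TYPE II) MODEL AT A SPLIT PLACE.**  For every section `s : U(J)(F_v) →* S̃p_{ψ_v}(𝕎_v)` over `ι_v`
there are an `L²(μ'ᴺ)`-ISOMETRIC linear automorphism `Γ` of `𝒮(F_vᴺ)` (an implementer of `J_v γ_w`) and a character
`η : U(J)(F_v) →* ℂˣ` such that, for every `a ∈ GL_N(F_v)` and the element `κ_a ∈ U(J)(F_v)` with `w`-component `ι_w(a)`
(`localPiSplitEquiv.symm (a.map ι_w)`), `ω_s(κ_a) Φ = η(κ_a) • Γ⁻¹ (r(m(a⁻ᵀ)) (Γ Φ))` with `r(m(b)) Φ = |det b|^{-1/2} Φ(b⁻¹ ·)`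
(`leviOpPi`), i.e. `GL_N` acts through `Φ ↦ |det a|^{1/2} Φ(ᵗa ·)` up to `η` and `Γ` — MVW's «A un caractère près, c'est
la représentation métaplectique … `M = σ ⊗ ν_m^{m′/2} ⊗ ν_{m′}^{m/2}`» for the type II pair `(GL_1, GL_N)`.
[cite: MoeglinVignerasWaldspurger1987, Chap. 3 §III.1; Liu2021, App. D, proof of Lemma D.1 (first paragraph), p. 126] -/
theorem exists_mixedModel (hc : c ≠ 1) (hJc : (J.map c)ᵀ = J) (w : UnitaryGroup.PlacesOver E v) (hw : c • w.1 ≠ w.1)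
    (hJw : IsUnit (placeForm J w.1)) [MeasurableSpace (v.adicCompletion F)] [BorelSpace (v.adicCompletion F)] (μ' : Measure (v.adicCompletion F)) [μ'.IsAddHaarMeasure]
    (s : localPi E c N J v →* LocalMp F N T v) (hs : ∀ g, MpPsi.proj _ (s g) = iota F E c N hcδ hδ hd T hT hJ v g) :
    ∃ (Γ : (SchwartzBruhat (Fin N → v.adicCompletion F)) ≃ₗ[ℂ] (SchwartzBruhat (Fin N → v.adicCompletion F))) (η : localPi E c N J v →* ℂˣ),
      (∀ Φ : (SchwartzBruhat (Fin N → v.adicCompletion F)), SchwartzBruhat.l2NormSq (Measure.pi fun _ : Fin N => μ') (Γ Φ) =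
          SchwartzBruhat.l2NormSq (Measure.pi fun _ : Fin N => μ') Φ) ∧
      ∀ (a : GL (Fin N) (v.adicCompletion F)) (Φ : (SchwartzBruhat (Fin N → v.adicCompletion F))),
        (MpPsi.toRep (localSchrodinger F N T v)).comp s
            ((localPiSplitEquiv c J hc hJc w hw hJw).symm (Matrix.GeneralLinearGroup.map (toPlace v w) a)) Φ =
          ((η ((localPiSplitEquiv c J hc hJc w hw hJw).symm (Matrix.GeneralLinearGroup.map (toPlace v w) a)) : ℂˣ) :
              ℂ) • Γ.symm (leviOpPi (glEquiv (GLn.contragredient a)) (Γ Φ)) := by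
  classical
  -- an isometric implementer `Γ` of `J_v γ_w`
  obtain ⟨Γ, hΓ, hΓi⟩ := exists_isometric_implementer_localSchrodinger (hTd := hTd) μ'
    (transportSp (localGram F N T v) (isUnit_det_localGram F N T hTd v) (SymplecticGroup.symJ _ _) *
      splitDarboux F E c N hcδ hδ hd T v hT w hw)
  -- `ι_w : F_v ≃+* E_w` (onto at a split place)
  let ιw : (v.adicCompletion F) ≃+* w.1.adicCompletion E :=
    RingEquiv.ofBijective (toPlace v w) ⟨(toPlace v w).injective, toPlace_surjective F E c hcδ hδ hd v w hw⟩
  -- the `w`-component of `κ ∈ U(J)(F_v)` read in `GL_N(F_v)`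
  let A : localPi E c N J v →* GL (Fin N) (v.adicCompletion F) :=
    (Matrix.GeneralLinearGroup.map (ιw.symm : w.1.adicCompletion E ≃+* (v.adicCompletion F)).toRingHom).comp
      (localPiSplitEquiv c J hc hJc w hw hJw).toMulEquiv.toMonoidHom
  have hA : ∀ κ, (localPiSplitEquiv c J hc hJc w hw hJw).symm (Matrix.GeneralLinearGroup.map (toPlace v w) (A κ)) = κ := by
    intro κ
    apply (localPiSplitEquiv c J hc hJc w hw hJw).injective
    rw [ContinuousMulEquiv.apply_symm_apply]
    refine Units.ext (Matrix.ext fun i j => ?_)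
    exact ιw.apply_symm_apply _
  have hA' : ∀ a : GL (Fin N) (v.adicCompletion F),
      A ((localPiSplitEquiv c J hc hJc w hw hJw).symm (Matrix.GeneralLinearGroup.map (toPlace v w) a)) = a := by
    intro a
    change Matrix.GeneralLinearGroup.map _
      (localPiSplitEquiv c J hc hJc w hw hJw ((localPiSplitEquiv c J hc hJc w hw hJw).symm _)) = a
    rw [ContinuousMulEquiv.apply_symm_apply]
    refine Units.ext (Matrix.ext fun i j => ?_)
    exact ιw.symm_apply_apply _
  -- the Levi operators `r(m(a⁻ᵀ))`, conjugated by `Γ`, as a homomorphism on `U(J)(F_v)`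
  let L : GL (Fin N) (v.adicCompletion F) →* ((SchwartzBruhat (Fin N → v.adicCompletion F)) ≃ₗ[ℂ] (SchwartzBruhat (Fin N → v.adicCompletion F))) :=
    MonoidHom.mk' (fun a => leviOpPi (glEquiv (GLn.contragredient a))) (leviOpPi_contragredient_mul F N v)
  let M : localPi E c N J v →* ((SchwartzBruhat (Fin N → v.adicCompletion F)) ≃ₗ[ℂ] (SchwartzBruhat (Fin N → v.adicCompletion F))) :=
    MonoidHom.mk' (fun κ => Γ⁻¹ * L (A κ) * Γ) (fun κ κ' => by rw [map_mul, map_mul]; group)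
  -- `M κ` implements `ι_v κ = (J_v γ_w)⁻¹ m(a_κ⁻ᵀ) (J_v γ_w)`
  have hM : ∀ κ, Implements (localSchrodinger F N T v) (ofSymplectic _ (iota F E c N hcδ hδ hd T hT hJ v κ)) (M κ) := by
    intro κ
    have hι := iota_symm_map_eq_conj F E c N hcδ hδ hd T hT hTd hJ v hc hJc w hw hJw (A κ)
    rw [hA] at hι
    rw [hι, map_mul, map_mul, map_inv]
    exact Implements.mul _ (Implements.mul _ (Implements.inv _ hΓ) (implements_leviOpPi F N T hTd v _)) hΓ
  -- the second section over `ι_v`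
  let s' : localPi E c N J v →* LocalMp F N T v := MonoidHom.mk'
    (fun κ => ⟨(iota F E c N hcδ hδ hd T hT hJ v κ, M κ), (mem_MpPsi _ _).2 (hM κ)⟩)
    (fun κ κ' => Subtype.ext (Prod.ext (map_mul _ κ κ') (map_mul M κ κ')))
  have hs' : ∀ g, MpPsi.proj _ (s g) = MpPsi.proj _ (s' g) := fun g => (hs g).trans rfl
  haveI : Nontrivial (SchwartzBruhat (Fin N → v.adicCompletion F)) := nontrivial_schwartzBruhat_pi
  obtain ⟨η, hη⟩ := MpPsi.exists_twist_toRep_comp_of_proj_eq (localSchrodinger F N T v)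
    (implementerUniqueUpToScalar_localSchrodinger F N T hTd v) s' s hs'
  refine ⟨Γ, η, hΓi, fun a Φ => ?_⟩
  rw [hη, SeesawScalar.twist_apply, MonoidHom.comp_apply, MpPsi.toRep_apply]
  congr 1
  change (Γ⁻¹ * L (A _) * Γ) Φ = _
  rw [hA', LinearEquiv.mul_apply, LinearEquiv.mul_apply, LinearEquiv.coe_inv]
  rfl

/-! ## §5 Unitarity of the character `η` -/

/-- `|c|ₑ² = 1 ⇒ |c| = 1` for a complex number (bookkeeping between `ℝ≥0∞`, `ℝ≥0` and `ℝ`). [folklore] -/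
private theorem norm_eq_one_of_enorm_sq_eq_one' {z : ℂ} (h : ‖z‖ₑ ^ 2 = 1) : ‖z‖ = 1 := by
  have h3 : (‖z‖₊ : NNReal) ^ 2 = 1 := by
    rw [enorm_eq_nnnorm, ← ENNReal.coe_pow, ENNReal.coe_eq_one] at h
    exact h
  have h4 : ‖z‖ ^ 2 = 1 := by
    have := congrArg (fun t : NNReal => (t : ℝ)) h3
    simpa only [NNReal.coe_pow, coe_nnnorm, NNReal.coe_one] using this
  exact (pow_eq_one_iff_of_nonneg (norm_nonneg _) two_ne_zero).1 h4

/-- **`L²`-isometry does not depend on the Haar measure**: two additive Haar measures on a second countable locally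
compact group differ by a scalar (Mathlib `Measure.isAddLeftInvariant_eq_smul`), and `‖·‖²_{L²(c•ν)} = c ‖·‖²_{L²(ν)}`.
[cite: Weil1964, Chap. I n° 11] -/
theorem _root_.Representation.IsL2Isometric.of_isAddHaarMeasure {G : Type*} [Monoid G] {X : Type*} [AddCommGroup X]
    [TopologicalSpace X] [IsTopologicalAddGroup X] [LocallyCompactSpace X] [SecondCountableTopology X]
    [MeasurableSpace X] [BorelSpace X] (ν₁ ν₂ : Measure X) [ν₁.IsAddHaarMeasure] [ν₂.IsAddHaarMeasure]
    {ρ : Representation ℂ G (SchwartzBruhat X)} (h : ρ.IsL2Isometric ν₁) : ρ.IsL2Isometric ν₂ := by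
  have hν : ν₂ = ν₂.addHaarScalarFactor ν₁ • ν₁ := Measure.isAddLeftInvariant_eq_smul ν₂ ν₁
  have hsc : ∀ Φ : SchwartzBruhat X, SchwartzBruhat.l2NormSq ν₂ Φ =
      (ν₂.addHaarScalarFactor ν₁ : ENNReal) * SchwartzBruhat.l2NormSq ν₁ Φ := by
    intro Φ
    rw [SchwartzBruhat.l2NormSq_def, SchwartzBruhat.l2NormSq_def]
    conv_lhs => rw [hν]
    rw [lintegral_smul_measure]
    rfl
  intro g Φ
  rw [hsc, hsc, h g Φ]

/-- **If `ω_s` is `L²`-isometric (for any Haar measure on `F_vᴺ`) then the character `η` of the mixed model is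
UNITARY** on the elements `κ_a`: both `ω_s` and the explicit model `Γ⁻¹ r(m(a⁻ᵀ)) Γ` (isometric `Γ`, `r(m(b))`
isometric by `l2NormSq_leviOpPi`) preserve `‖·‖²_{L²}`, and `𝒮(F_vᴺ) ≠ 0`.
[cite: GelbartRogawski1991, §3.1 Remark p. 457 L4–13; Weil1964, Chap. I n° 13] -/
theorem norm_eq_one_of_mixedModel (hc : c ≠ 1) (hJc : (J.map c)ᵀ = J) (w : UnitaryGroup.PlacesOver E v)
    (hw : c • w.1 ≠ w.1) (hJw : IsUnit (placeForm J w.1)) [MeasurableSpace (v.adicCompletion F)] [BorelSpace (v.adicCompletion F)] (μ' : Measure (v.adicCompletion F))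
    [μ'.IsAddHaarMeasure] (s : localPi E c N J v →* LocalMp F N T v) (Γ : (SchwartzBruhat (Fin N → v.adicCompletion F)) ≃ₗ[ℂ] (SchwartzBruhat (Fin N → v.adicCompletion F))) (η : localPi E c N J v →* ℂˣ)
    (hΓ : ∀ Φ : (SchwartzBruhat (Fin N → v.adicCompletion F)), SchwartzBruhat.l2NormSq (Measure.pi fun _ : Fin N => μ') (Γ Φ) =
      SchwartzBruhat.l2NormSq (Measure.pi fun _ : Fin N => μ') Φ)
    (hmodel : ∀ (a : GL (Fin N) (v.adicCompletion F)) (Φ : (SchwartzBruhat (Fin N → v.adicCompletion F))),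
      (MpPsi.toRep (localSchrodinger F N T v)).comp s
          ((localPiSplitEquiv c J hc hJc w hw hJw).symm (Matrix.GeneralLinearGroup.map (toPlace v w) a)) Φ =
        ((η ((localPiSplitEquiv c J hc hJc w hw hJw).symm (Matrix.GeneralLinearGroup.map (toPlace v w) a)) : ℂˣ) :
            ℂ) • Γ.symm (leviOpPi (glEquiv (GLn.contragredient a)) (Γ Φ)))
    (μX : Measure (Fin N → (v.adicCompletion F))) [μX.IsAddHaarMeasure]
    (hsu : Representation.IsL2Isometric μX ((MpPsi.toRep (localSchrodinger F N T v)).comp s)) (a : GL (Fin N) (v.adicCompletion F)) :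
    ‖((η ((localPiSplitEquiv c J hc hJc w hw hJw).symm (Matrix.GeneralLinearGroup.map (toPlace v w) a)) : ℂˣ) : ℂ)‖ =
      1 := by
  haveI := secondCountableTopology_adicCompletion F v
  haveI : Nontrivial (SchwartzBruhat (Fin N → v.adicCompletion F)) := nontrivial_schwartzBruhat_pi
  have hsu' : Representation.IsL2Isometric (Measure.pi fun _ : Fin N => μ')
      ((MpPsi.toRep (localSchrodinger F N T v)).comp s) :=
    hsu.of_isAddHaarMeasure μX (Measure.pi fun _ : Fin N => μ')
  -- the two representations of `GL_N(F_v)` on `𝒮(F_vᴺ)` (packaged opaquely)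
  obtain ⟨φ, hφ⟩ : ∃ φ : GL (Fin N) (v.adicCompletion F) →* localPi E c N J v, ∀ g,
      φ g = (localPiSplitEquiv c J hc hJc w hw hJw).symm (Matrix.GeneralLinearGroup.map (toPlace v w) g) :=
    ⟨(localPiSplitEquiv c J hc hJc w hw hJw).symm.toMulEquiv.toMonoidHom.comp
      (Matrix.GeneralLinearGroup.map (toPlace v w)), fun _ => rfl⟩
  obtain ⟨ρ', hρ'apply⟩ : ∃ ρ' : Representation ℂ (GL (Fin N) (v.adicCompletion F)) (SchwartzBruhat (Fin N → v.adicCompletion F)), ∀ (g : GL (Fin N) (v.adicCompletion F)) (Φ : (SchwartzBruhat (Fin N → v.adicCompletion F))),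
      ρ' g Φ = (MpPsi.toRep (localSchrodinger F N T v)).comp s (φ g) Φ :=
    ⟨((MpPsi.toRep (localSchrodinger F N T v)).comp s).comp φ, fun _ _ => rfl⟩
  obtain ⟨ρ, hρapply⟩ : ∃ ρ : Representation ℂ (GL (Fin N) (v.adicCompletion F)) (SchwartzBruhat (Fin N → v.adicCompletion F)), ∀ (g : GL (Fin N) (v.adicCompletion F)) (Φ : (SchwartzBruhat (Fin N → v.adicCompletion F))),
      ρ g Φ = Γ.symm (leviOpPi (glEquiv (GLn.contragredient g)) (Γ Φ)) := by
    let L : GL (Fin N) (v.adicCompletion F) →* ((SchwartzBruhat (Fin N → v.adicCompletion F)) ≃ₗ[ℂ] (SchwartzBruhat (Fin N → v.adicCompletion F))) :=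
      MonoidHom.mk' (fun a => leviOpPi (glEquiv (GLn.contragredient a))) (leviOpPi_contragredient_mul F N v)
    let M : GL (Fin N) (v.adicCompletion F) →* ((SchwartzBruhat (Fin N → v.adicCompletion F)) ≃ₗ[ℂ] (SchwartzBruhat (Fin N → v.adicCompletion F))) :=
      MonoidHom.mk' (fun a => Γ⁻¹ * L a * Γ) (fun a a' => by rw [map_mul]; group)
    refine ⟨(LinearEquiv.automorphismGroup.toLinearMapMonoidHom).comp M, fun g Φ => ?_⟩
    change (Γ⁻¹ * L g * Γ) Φ = _
    rw [LinearEquiv.mul_apply, LinearEquiv.mul_apply, LinearEquiv.coe_inv]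
    rfl
  have hΓ' : ∀ Φ : (SchwartzBruhat (Fin N → v.adicCompletion F)), SchwartzBruhat.l2NormSq (Measure.pi fun _ : Fin N => μ') (Γ.symm Φ) =
      SchwartzBruhat.l2NormSq (Measure.pi fun _ : Fin N => μ') Φ := fun Φ => by
    conv_rhs => rw [← Γ.apply_symm_apply Φ]
    exact (hΓ _).symm
  have hρ : ∀ (g : GL (Fin N) (v.adicCompletion F)) (Φ : (SchwartzBruhat (Fin N → v.adicCompletion F))), SchwartzBruhat.l2NormSq (Measure.pi fun _ : Fin N => μ') (ρ g Φ) =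
      SchwartzBruhat.l2NormSq (Measure.pi fun _ : Fin N => μ') Φ := fun g Φ => by
    rw [hρapply, hΓ', l2NormSq_leviOpPi, hΓ]
  have hρ' : ∀ (g : GL (Fin N) (v.adicCompletion F)) (Φ : (SchwartzBruhat (Fin N → v.adicCompletion F))), SchwartzBruhat.l2NormSq (Measure.pi fun _ : Fin N => μ') (ρ' g Φ) =
      SchwartzBruhat.l2NormSq (Measure.pi fun _ : Fin N => μ') Φ := fun g Φ => by
    rw [hρ'apply]; exact hsu' (φ g) Φ
  have hηeq : ∀ (g : GL (Fin N) (v.adicCompletion F)) (Φ : (SchwartzBruhat (Fin N → v.adicCompletion F))), ρ' g Φ = ((η (φ g) : ℂˣ) : ℂ) • ρ g Φ := fun g Φ => by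
    rw [hρ'apply, hρapply, hφ, hmodel]
  obtain ⟨Φ₀, hΦ₀⟩ := exists_ne (0 : (SchwartzBruhat (Fin N → v.adicCompletion F)))
  have h0 : SchwartzBruhat.l2NormSq (Measure.pi fun _ : Fin N => μ') Φ₀ ≠ 0 := (SchwartzBruhat.l2NormSq_pos _ hΦ₀).ne'
  have htop : SchwartzBruhat.l2NormSq (Measure.pi fun _ : Fin N => μ') Φ₀ ≠ ⊤ := SchwartzBruhat.l2NormSq_ne_top _ Φ₀
  have h1 : ‖((η (φ a) : ℂˣ) : ℂ)‖ₑ ^ 2 * SchwartzBruhat.l2NormSq (Measure.pi fun _ : Fin N => μ') Φ₀ =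
      1 * SchwartzBruhat.l2NormSq (Measure.pi fun _ : Fin N => μ') Φ₀ := by
    rw [one_mul]
    conv_rhs => rw [← hρ' a Φ₀, hηeq, SchwartzBruhat.l2NormSq_smul, hρ a Φ₀]
  rw [← hφ]
  exact norm_eq_one_of_enorm_sq_eq_one' ((ENNReal.mul_left_inj h0 htop).1 h1)

/-! ## §6 The centre `U(J₁)(F_v)` acts through scalars of `GL_N(F_v)` -/

include hd in
/-- **The local centre is `κ_{t · 1}`**: for `z₀ ∈ U(J₁)(F_v) = E_v¹` with `w`-component `ζ = (z₀)_w`, the scalar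
`localCenter z₀ = ζ · 1_N ∈ U(J)(F_v)` is the element `κ_{a₀}` of `w`-component `ι_w(a₀)` for the scalar matrix
`a₀ = a_w(ζ) · 1_N ∈ GL_N(F_v)` (`ι_w(a_w(ζ)) = ζ`, tree `toPlace_splitCoord`). [cite: Mok2014, §1 Notation p. 5] -/
theorem localCenter_eq_symm_map (hc : c ≠ 1) (hJc : (J.map c)ᵀ = J) (w : UnitaryGroup.PlacesOver E v)
    (hw : c • w.1 ≠ w.1) (hJw : IsUnit (placeForm J w.1)) {J₁ : Matrix (Fin 1) (Fin 1) E} (hJ₁ : J₁ 0 0 ≠ 0)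
    (z₀ : localPi E c 1 J₁ v) (a₀ : GL (Fin N) (v.adicCompletion F))
    (ha₀ : (a₀ : Matrix (Fin N) (Fin N) (v.adicCompletion F)) =
      splitCoord F E c hcδ hδ v w
        (fun w' => (((z₀ : LocalGLPi E 1 v) w' : GL (Fin 1) (w'.1.adicCompletion E)) :
          Matrix (Fin 1) (Fin 1) (w'.1.adicCompletion E)) 0 0) • (1 : Matrix (Fin N) (Fin N) (v.adicCompletion F))) :
    localCenter E c N J J₁ hJ₁ v z₀ =
      (localPiSplitEquiv c J hc hJc w hw hJw).symm (Matrix.GeneralLinearGroup.map (toPlace v w) a₀) := by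
  apply (localPiSplitEquiv c J hc hJc w hw hJw).injective
  rw [ContinuousMulEquiv.apply_symm_apply, localPiSplitEquiv_apply]
  refine Units.ext (Matrix.ext fun i j => ?_)
  change ((localScalarGL E N v (z₀ : LocalGLPi E 1 v) w : GL (Fin N) (w.1.adicCompletion E)) : Matrix _ _ _) i j =
    toPlace v w ((a₀ : Matrix (Fin N) (Fin N) (v.adicCompletion F)) i j)
  rw [coe_localScalarGL_apply, ha₀, Matrix.smul_apply, Matrix.smul_apply, smul_eq_mul, smul_eq_mul, map_mul,
    toPlace_splitCoord F E c hcδ hδ hd v w hw]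
  by_cases hij : i = j
  · subst hij
    rw [Matrix.one_apply_eq, Matrix.one_apply_eq, map_one]
  · rw [Matrix.one_apply_ne hij, Matrix.one_apply_ne hij, map_zero]

/-- **the centre acts by homotheties**: for the scalar `a₀ = t · 1_N`, `(r(m(a₀⁻ᵀ)) Φ)(x) = c · Φ(t x)` with the
positive constant `c = (modSqrt (glEquiv a₀⁻ᵀ))⁻¹ = |t|^{N/2}`. [cite: MoeglinVignerasWaldspurger1987, Chap. 3 §III.1] -/
theorem coe_leviOpPi_contragredient_scalar_apply {t : (v.adicCompletion F)} {a₀ : GL (Fin N) (v.adicCompletion F)}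
    (ha₀ : (a₀ : Matrix (Fin N) (Fin N) (v.adicCompletion F)) = t • (1 : Matrix (Fin N) (Fin N) (v.adicCompletion F))) (Φ : (SchwartzBruhat (Fin N → v.adicCompletion F))) (x : Fin N → (v.adicCompletion F)) :
    ((leviOpPi (glEquiv (GLn.contragredient a₀)) Φ : (SchwartzBruhat (Fin N → v.adicCompletion F))) : (Fin N → (v.adicCompletion F)) → ℂ) x =
      ((modSqrt (glEquiv (GLn.contragredient a₀)) : ℂ))⁻¹ * (Φ : (Fin N → (v.adicCompletion F)) → ℂ) (t • x) := by
  rw [coe_leviOpPi_contragredient_apply, ha₀, Matrix.transpose_smul, Matrix.transpose_one, Matrix.smul_mulVec,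
    Matrix.one_mulVec]

end Place

end Literature.NumberTheory.Automorphic.Liu2021.SplitPlaceMixedModel

end
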